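import Summits.BirchSwinnertonDyer.Rank1Residual.SecondDescent.ShaExponentFromNonDivisible
import Summits.BirchSwinnertonDyer.Rank1Residual.X11b.Three.NineDescentCertificate
import HarnessLib

/-!
# `BSD(E,p)` in analytic rank `≤ 1` from ONE complete `p`-descent plus ONE second-descent `EMPTY`
# certificate (cell `b2b-bsdres`, CLASS-CLOSURE instrument B-1 `SEL3CT-ALT`, seat cc-eng-4)

HONEST FRAMING (cell `b2b-bsdres`, run/shared/lean/b2b/bsd-rank1-residual/, verbatim in every
file): the goal of the cell is to DELETE the COMBINATION-SHAPED residual classes of the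
Birch–Swinnerton-Dyer formula for ALL analytic-rank `≤ 1` elliptic curves over `ℚ` — "full BSD
formula for every rank `≤ 1` curve in class `C`" assembled STRICTLY from published theorems — so
that the rank-`≤ 1` remainder becomes exactly the CONSTRUCTION-SHAPED classes, which are TYPED
(missing-input `Prop`s), NOT attempted. This is not "finishing BSD". Per-pair certificate
consumers; NOT class theorems; nothing here is booked (the lane books); the rows named below are
EVIDENCE pointers (instrument targets), never inputs. THEOREMS ONLY (no definition, no named fact,
no `sorry`).

## What this file does

`X11b/Three/NineDescentCertificate.lean` closes `BSD(E,p)` in analytic rank `≤ 1` from TWO exact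
descent counts `#Sel^(p)` and `#Sel^(p²)`.  A second `p`-descent instrument (B-1; Creutz 2014) does
not output `#Sel^(p²)`; it outputs, for ONE torsor `C` representing a class `c ∈ Ш(E/ℚ)[p]`, the
verdict `EMPTY` = "`c` is not a `p`-th multiple in `Ш`".  With the Cassels–Tate pairing
(`exists_casselsTate_pairing`, Silverman *AEC* X.4.14 — the tree's named fact, as in every
`…_of_casselsTate_…` consumer of this directory) that single verdict forces `Ш[p²] = Ш[p]` when
`#Ш[p] = p²` (`SecondDescent/ShaExponentFromNonDivisible.lean`).  Hence:

* `bsdp_of_card_selmer_of_casselsTate_of_not_divisible` (§1, class-free, every prime, `r_an ≤ 1`):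
  GZK (`hGZK`) + CT (`hCT`) + `#E(ℚ)[p] = b` + ONE complete descent `#Sel^(p)(E/ℚ) = p^(r_an) · b · p²`
  + ONE class `c`, `p • c = 0`, not of the form `p • d` + `ord_p #Ш_an = 2` ⇒ `BSD(E,p)`;
* `bsdp_of_irr_of_card_selmer_of_casselsTate_of_not_divisible`: `b = 1` discharged by `E[p]`
  irreducible (Mazur 1977, tree `natCard_torsionBy_eq_one_of_hasIrreducibleModPGaloisRep`);
* §2, `p = 3`: the rank-ONE `#Ш_an = 9` shape in x11b3's vocabulary
  (`Three.bsdp_three_of_card_selmerThree_eq_27_of_casselsTate_of_not_divisible`: `IsX11Three W`,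
  `#Sel₃ = 27`, one `EMPTY` class, `ord₃ #Ш_an = 2` ⇒ `BSD(E,3)` — E-K10(a)'s `#Sel₉ = 81` input
  REPLACED by the B-1 certificate + CT) and the rank-ZERO shape
  (`bsdp_three_rankZero_of_card_selmerThree_eq_nine_of_casselsTate_of_not_divisible`: `r_an = 0`,
  irr(3), `#Sel₃ = 9`, one `EMPTY` class, `ord₃ #Ш_an = 2` ⇒ `BSD(E,3)` — the N11 window atoms /
  X10a′ reading of B-1's RUNBOOK §5).

EVIDENCE pointers only (instrument targets of `class-closure/eng-4/b1/production-staged-g5/`,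
nothing run, nothing booked): X11b@3 (T2′) classes `191424ce1 318828a1 368358k1 463488bg1 498525ca1`
(+ `397848o1 443400c1`); N11 atoms `15930u1 19656b1 11286q1`. The B-1 records are lane-internal E4
instrumentation under census-lead's tier label; a class team instantiates `c`/`hndiv`/`#Sel₃` from
them only under that label, and the referee books.
-/

noncomputable section

open scoped Classical

open WeierstrassCurve NumberField Literature.NumberTheory.EllipticCurves
open Literature.NumberTheory.EllipticCurves.Rank1Residual
open Literature.NumberTheory.EllipticCurves.Rank1Residual.Typed

namespace Summit.BirchSwinnertonDyer.Rank1Residual.SecondDescent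

/-! ### §1. Class-free, every prime `p`, analytic rank `≤ 1` -/

section AnyPrime

variable (W : WeierstrassCurve ℚ) [W.IsElliptic] (p : ℕ) [hp : Fact p.Prime]

/-- **`BSD(E,p)` from one complete `p`-descent + one second-descent `EMPTY` class + Cassels–Tate,
analytic rank `≤ 1`, every prime.** Hypotheses: GZK (`hGZK`: `rank = r_an`, `Ш` finite); the
Cassels–Tate pairing fact (`hCT`); `#E(ℚ)[p] = b`; `#Sel^(p)(E/ℚ) = p^(r_an) · b · p²` (so
`#Ш[p] = p²`); ONE `c ∈ Ш`, `p • c = 0`, that is not a `p`-th multiple in `Ш` (a second `p`-descent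
`EMPTY` verdict for a torsor representing `c`); `#Ш(E)_an = q` with `ord_p q = 2`. Then `Ш[p²] = Ш[p]`
(`sha_nsmul_eq_zero_of_sq_of_casselsTate_of_not_divisible`) and `bsdp_of_card_selmer_stable` closes.
Per pair; not a class theorem; nothing booked. [cite: SilvermanAEC2009, Thm. X.4.2(a) and Thm. X.4.14]
[cite: Creutz2014, §1] [cite: Miller2011LMS, §1 and Def. 1.1] -/
theorem bsdp_of_card_selmer_of_casselsTate_of_not_divisible
    (hGZK : rank_eq_analyticRank_of_analyticRank_le_one)
    (hCT : exists_casselsTate_pairing (K := ℚ)) (hr : W.analyticRank ≤ 1) {b : ℕ}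
    (htors : Nat.card (AddSubgroup.torsionBy W.toAffine.Point (p : ℤ)) = b) (hb : 0 < b)
    (hSel : Nat.card (W.selmerGroup (p : ℤ)) = p ^ W.analyticRank * b * p ^ 2)
    {c : W.sha} (hpc : p • c = 0) (hndiv : ∀ d : W.sha, p • d ≠ c)
    {q : ℚ} (hq : shaAn W = (q : ℂ)) (hv : padicValRat p q = 2) : BSDp W p := by
  obtain ⟨hrank, hfin⟩ := hGZK W hr
  haveI : Finite W.sha := hfin
  -- transport the computable `DecidableEq ℚ` of the binder to the classical one of the general
  -- number-field theorems (as in `Typed/HigherDescentSelmerCertificate.lean`)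
  have hinst : (instDecidableEqRat : DecidableEq ℚ) = fun a b => Classical.propDecidable (a = b) :=
    Subsingleton.elim _ _
  have htors' := htors
  rw [hinst] at htors'
  -- `#Ш[p] = p²` from the one complete descent
  have hcard : Nat.card (AddSubgroup.torsionBy W.sha (p : ℕ)) = p ^ 2 :=
    card_torsionBy_sha_eq_of_card_selmerGroup W p (a := p ^ W.analyticRank * b)
      (by rw [hrank, htors']) (Nat.mul_pos (pow_pos hp.out.pos _) hb) hSel
  -- the `EMPTY` class + Cassels–Tate ⇒ `Ш[p²] = Ш[p]`
  have hstab : ∀ x : W.sha, p ^ (1 + 1) • x = 0 → p ^ 1 • x = 0 := by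
    intro x hx
    rw [pow_one]
    exact sha_nsmul_eq_zero_of_sq_of_casselsTate_of_not_divisible hCT W hp.out hcard hpc hndiv x hx
  refine bsdp_of_card_selmer_stable W p hGZK hr (k := 1) (m := 2) (b := b) ?_ hb ?_ hstab hq hv
  · rw [pow_one]; exact htors
  · rw [pow_one, hSel]

/-- **The same with `#E(ℚ)[p] = 1` discharged by irreducibility of `E[p]`** (Mazur 1977 p. 157, tree
`natCard_torsionBy_eq_one_of_hasIrreducibleModPGaloisRep`): GZK + CT + irr(p) +
`#Sel^(p)(E/ℚ) = p^(r_an + 2)` + one `EMPTY` class + `ord_p #Ш_an = 2` ⇒ `BSD(E,p)`. Per pair;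
nothing booked. [cite: Mazur1977, Ch. III §5, p. 157] [cite: SilvermanAEC2009, Thm. X.4.2(a)]
[cite: Miller2011LMS, §1 and Def. 1.1] -/
theorem bsdp_of_irr_of_card_selmer_of_casselsTate_of_not_divisible
    (hGZK : rank_eq_analyticRank_of_analyticRank_le_one)
    (hCT : exists_casselsTate_pairing (K := ℚ)) (hr : W.analyticRank ≤ 1) (hirr : Irr W p)
    (hSel : Nat.card (W.selmerGroup (p : ℤ)) = p ^ (W.analyticRank + 2))
    {c : W.sha} (hpc : p • c = 0) (hndiv : ∀ d : W.sha, p • d ≠ c)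
    {q : ℚ} (hq : shaAn W = (q : ℂ)) (hv : padicValRat p q = 2) : BSDp W p :=
  bsdp_of_card_selmer_of_casselsTate_of_not_divisible W p hGZK hCT hr
    (natCard_torsionBy_eq_one_of_hasIrreducibleModPGaloisRep W p hirr) Nat.one_pos
    (by rw [hSel, pow_add, mul_one]) hpc hndiv hq hv

end AnyPrime

/-! ### §2. `p = 3`: the `#Ш_an = 9` rows (rank one: X11b@3; rank zero: N11 atoms, X10a′) -/

section Three

/-- **X11 at `p = 3`, analytic rank one (`IsX11Three W`): `#Sel^(3)(E/ℚ) = 27` (x11b LB3, EXACT) +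
ONE second-`3`-descent `EMPTY` class + Cassels–Tate + `ord₃ #Ш_an = 2` ⇒ `BSD(E,3)`.** This is
E-K10(a) (`Three.bsdp_of_card_selmerThree_eq_of_card_selmerNine_eq`) with the `#Sel^(9) = 81` count
REPLACED by the B-1 certificate: `Ш[9] = Ш[3]` follows from `EMPTY` + CT, not from a `9`-descent.
Inputs beyond the pair: GZK and the Cassels–Tate pairing fact. EVIDENCE pointers (targets, not
inputs): the (T2′) classes `191424ce1 318828a1 368358k1 463488bg1 498525ca1` (+ `397848o1`,
`443400c1`). Per pair; X11 ∧ `r = 1` ∧ `p = 3` stays CONSTRUCTION-SHAPED; nothing booked.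
[cite: SilvermanAEC2009, Thm. X.4.2(a) and Thm. X.4.14] [cite: Creutz2014, §1]
[cite: Miller2011LMS, §1 and Def. 1.1] -/
theorem Three.bsdp_three_of_card_selmerThree_eq_27_of_casselsTate_of_not_divisible
    (hGZK : rank_eq_analyticRank_of_analyticRank_le_one)
    (hCT : exists_casselsTate_pairing (K := ℚ)) (W : WeierstrassCurve ℚ) [W.IsElliptic]
    (hX : IsX11Three W) (h3 : Nat.card (W.selmerGroup (3 : ℤ)) = 27)
    {c : W.sha} (h3c : 3 • c = 0) (hndiv : ∀ d : W.sha, 3 • d ≠ c)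
    {s : ℚ} (hs : shaAn W = (s : ℂ)) (hv : padicValRat 3 s = 2) : BSDp W 3 :=
  haveI : Fact (Nat.Prime 3) := ⟨Nat.prime_three⟩
  bsdp_of_irr_of_card_selmer_of_casselsTate_of_not_divisible W 3 hGZK hCT hX.rank.le hX.irr
    (by rw [hX.rank, show ((3 : ℕ) : ℤ) = 3 by norm_num, h3]; norm_num) h3c hndiv hs hv

/-- **Analytic rank ZERO, `p = 3`, `E[3]` irreducible: `#Sel^(3)(E/ℚ) = 9` (EXACT) + ONE
second-`3`-descent `EMPTY` class + Cassels–Tate + `ord₃ #Ш_an = 2` ⇒ `BSD(E,3)`** — B-1's RUNBOOK §5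
reading for rank-zero `#Ш_an = 9` rows (N11 window atoms `15930u1 19656b1 11286q1`; the X10a′ rows),
as a kernel statement. Inputs beyond the pair: GZK, the Cassels–Tate pairing fact. Per pair;
nothing booked. [cite: SilvermanAEC2009, Thm. X.4.2(a) and Thm. X.4.14] [cite: Creutz2014, §1]
[cite: Miller2011LMS, §1 and Def. 1.1] -/
theorem bsdp_three_rankZero_of_card_selmerThree_eq_nine_of_casselsTate_of_not_divisible
    (hGZK : rank_eq_analyticRank_of_analyticRank_le_one)
    (hCT : exists_casselsTate_pairing (K := ℚ)) (W : WeierstrassCurve ℚ) [W.IsElliptic]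
    (hr : W.analyticRank = 0) (hirr : Irr W 3) (h3 : Nat.card (W.selmerGroup (3 : ℤ)) = 9)
    {c : W.sha} (h3c : 3 • c = 0) (hndiv : ∀ d : W.sha, 3 • d ≠ c)
    {s : ℚ} (hs : shaAn W = (s : ℂ)) (hv : padicValRat 3 s = 2) : BSDp W 3 :=
  haveI : Fact (Nat.Prime 3) := ⟨Nat.prime_three⟩
  bsdp_of_irr_of_card_selmer_of_casselsTate_of_not_divisible W 3 hGZK hCT (by rw [hr]; norm_num)
    hirr (by rw [hr, show ((3 : ℕ) : ℤ) = 3 by norm_num, h3]; norm_num) h3c hndiv hs hv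

end Three

end Summit.BirchSwinnertonDyer.Rank1Residual.SecondDescent

end
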